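import Mathlib
import HarnessLib
import Summits.ValiantsHypothesis.ValiantsHypothesis.Theses.MonotoneRestoration
import Literature.Computability.AlgebraicComplexity.ArithCircuit
import Literature.Computability.AlgebraicComplexity.ArithCircuitProofs
import Literature.Computability.AlgebraicComplexity.MonotoneStructure
import Literature.Computability.AlgebraicComplexity.PermanentIrreducible
import Literature.ModelTheory.FiniteModelTheory.CkEquiv
import Summits.ValiantsHypothesis.ValiantsHypothesis.Theorems.MonotoneRestorationMonotoneRestorationQPCosetCount
import Summits.ValiantsHypothesis.ValiantsHypothesis.Theorems.MonotoneRestorationMonotoneRestorationQPSymmetricLB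
import Summits.ValiantsHypothesis.ValiantsHypothesis.Theorems.MonotoneRestorationMonotoneRestorationQPSupportSymmetrisation
import Summits.ValiantsHypothesis.ValiantsHypothesis.Theorems.MonotoneRestorationMonotoneRestorationQPSparseRegime
import Summits.ValiantsHypothesis.ValiantsHypothesis.Theorems.MonotoneRestorationMonotoneRestorationQPBeta
import Literature.Computability.AlgebraicComplexity.SymmetricArithCircuit
import Literature.Computability.AlgebraicComplexity.DawarWilsenach2025Proofs
import Literature.GroupTheory.PermutationGroups.SmallIndexSubgroups
import Summits.ValiantsHypothesis.ValiantsHypothesis.Theorems.MonotoneRestorationQP.Negative.LoadBearing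
import Summits.ValiantsHypothesis.ValiantsHypothesis.Theorems.MonotoneRestorationMonotoneRestorationQPPermSupportCount

/-! TTRL-lite variant V18934 of stmt-ValiantsHypothesis-15886 -/

-- `Summit.ValiantsHypothesis.ValiantsHypothesis.…` is the tree's mandated single-conjunct layout
-- (Sub = Summit), so the duplicated namespace component is intended.
set_option linter.dupNamespace false

namespace Summit.ValiantsHypothesis.ValiantsHypothesis.Theorems

open Summit.ValiantsHypothesis.ValiantsHypothesis.Theses.MonotoneRestoration
open Literature.Computability.AlgebraicComplexity

/-- **TTRL-lite variant V18934** (`generalise`: coefficients in `ℤ` instead of `ℝ≥0`) of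
`stub_mulGate_children_extend` (item `stmt-ValiantsHypothesis-15886`) is FALSE: with signed
coefficients a product can cancel monomials, so a common shift of the product's support into
`f.support` need not restrict to a shift of a factor's support.  Witness (one variable `v`):
`p = 1 + X v`, `q = 1 - X v`, `f = p * q = 1 - X v ^ 2`; the hypothesis holds with `μ = 0`, but
`p.support = {0, v}` while every monomial of `f` has `v`-degree `0` or `2`, so no shift `μ` puts both
`μ` and `v + μ` in `f.support`.  This pins monotonicity (`ℝ≥0`, no cancellation) as essential for the
stub. [folklore] -/
theorem stub_mulGate_children_extend_var18934_false :
    ¬ (∀ (p q f : MvPolynomial (Fin 1 × Fin 1) ℤ), p * q ≠ 0 →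
        (∃ μ : (Fin 1 × Fin 1) →₀ ℕ, ∀ m ∈ (p * q).support, m + μ ∈ f.support) →
        ∃ μ : (Fin 1 × Fin 1) →₀ ℕ, ∀ m ∈ p.support, m + μ ∈ f.support) := by
  intro h
  suffices key : ∀ v : Fin 1 × Fin 1, False from key (0, 0)
  intro v
  -- the witness product, computed
  have hpq : ((1 + MvPolynomial.X v) * (1 - MvPolynomial.X v) : MvPolynomial (Fin 1 × Fin 1) ℤ)
      = 1 - MvPolynomial.X v ^ 2 := by ring
  -- it is nonzero (constant coefficient `1`)
  have hne : ((1 + MvPolynomial.X v) * (1 - MvPolynomial.X v) : MvPolynomial (Fin 1 × Fin 1) ℤ)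
      ≠ 0 := by
    intro h0
    have h1 := congrArg MvPolynomial.constantCoeff h0
    simp at h1
  -- every monomial of `1 - X v ^ 2` has `v`-degree `0` or `2`
  have hsupp : ∀ m : (Fin 1 × Fin 1) →₀ ℕ,
      m ∈ (1 - MvPolynomial.X v ^ 2 : MvPolynomial (Fin 1 × Fin 1) ℤ).support →
        m v = 0 ∨ m v = 2 := by
    intro m hm
    rw [MvPolynomial.mem_support_iff, MvPolynomial.coeff_sub, MvPolynomial.coeff_one,
      MvPolynomial.coeff_X_pow] at hm
    by_cases h0 : (0 : (Fin 1 × Fin 1) →₀ ℕ) = m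
    · left
      rw [← h0]
      simp
    · by_cases h2 : Finsupp.single v 2 = m
      · right
        rw [← h2]
        simp
      · rw [if_neg h0, if_neg h2] at hm
        exact absurd rfl hm
  -- the two monomials of `p = 1 + X v`
  have h01 : ¬ ((0 : (Fin 1 × Fin 1) →₀ ℕ) = Finsupp.single v 1) := by
    intro h0
    have h1 := DFunLike.congr_fun h0 v
    simp at h1
  have hp0 : (0 : (Fin 1 × Fin 1) →₀ ℕ)
      ∈ (1 + MvPolynomial.X v : MvPolynomial (Fin 1 × Fin 1) ℤ).support := by
    rw [MvPolynomial.mem_support_iff, MvPolynomial.coeff_add, MvPolynomial.coeff_one,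
      MvPolynomial.coeff_X, if_pos rfl, if_neg (fun e => h01 e.symm)]
    norm_num
  have hp1 : Finsupp.single v 1
      ∈ (1 + MvPolynomial.X v : MvPolynomial (Fin 1 × Fin 1) ℤ).support := by
    rw [MvPolynomial.mem_support_iff, MvPolynomial.coeff_add, MvPolynomial.coeff_one,
      MvPolynomial.coeff_X, if_neg h01, if_pos rfl]
    norm_num
  -- instantiate the claimed implication at the witness (hypothesis holds with `μ = 0`)
  obtain ⟨μ, hμ⟩ := h (1 + MvPolynomial.X v) (1 - MvPolynomial.X v)
    ((1 + MvPolynomial.X v) * (1 - MvPolynomial.X v)) hne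
    ⟨0, fun m hm => by rw [add_zero]; exact hm⟩
  have ha := hμ 0 hp0
  rw [zero_add, hpq] at ha
  have hb := hμ _ hp1
  rw [hpq] at hb
  have ha' := hsupp μ ha
  have hb' := hsupp _ hb
  simp only [Finsupp.add_apply, Finsupp.single_eq_same] at hb'
  omega

end Summit.ValiantsHypothesis.ValiantsHypothesis.Theorems
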